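import Literature.MathematicalPhysics.QuantumManyBody.BoseGasHardLayerLines
import Literature.MathematicalPhysics.QuantumManyBody.BoseGasLineGeometry
import Literature.MathematicalPhysics.QuantumManyBody.PeriodicFormDomain
import Literature.Analysis.FunctionSpaces.TorusLineTrigSums
import HarnessLib

/-!
# The volume of near-coincidences on the torus

Topic `Literature/MathematicalPhysics/QuantumManyBody`, sequel of `BoseGasHardLayerLines.lean`. On the torus `(ℝ/ℤ)^{3N}` (Haar
probability measure) the configurations `fromUnitTorusN L t` with some image pair closer than `r ≤ L/2` have measure
`≤ N² (8r/L)³` (`volume_exists_pairRad_lt_le`). Proof by three shears: along the lines of particle `i` in direction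
`k` the condition `|(xᵢ - xⱼ)_k - Lm| < r` is met on a set of parameters of length `≤ 8r/L` (`volume_shear_le`, via the
translation–Tonelli identity `Torus.lintegral_lintegral_line_eq`).

Tagged folklore.
-/

noncomputable section

open MeasureTheory Set Metric Filter Topology
open scoped ENNReal

namespace Literature.MathematicalPhysics.QuantumManyBody.BoseGas

-- The measure on `ℝ/ℤ` is the Haar PROBABILITY measure, as in `PeriodicFormDomain.lean`.
attribute [local instance] formDomain_measureSpace formDomain_isProbabilityMeasure formDomain_isProbabilityMeasure_pi

variable {N : ℕ} {L : ℝ}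

namespace HardLayerAux
open Literature.Analysis.FunctionSpaces

/-- Coordinates of the representative: `(fromUnitTorusN L t)ᵢₖ = L · rep(t(i,k)) ∈ (0, L]`. [folklore] -/
theorem fromUnitTorusN_apply_apply (L : ℝ) (t : UnitAddTorus (Fin N × Fin 3)) (i : Fin N) (k : Fin 3) :
    fromUnitTorusN L t i k = L * ((AddCircle.equivIoc 1 0 (t (i, k)) : ℝ)) := rfl

/-- Coordinates of the representative lie in `(0, L]` (`0 < L`). [folklore] -/
theorem fromUnitTorusN_apply_apply_mem (hL : 0 < L) (t : UnitAddTorus (Fin N × Fin 3)) (i : Fin N) (k : Fin 3) :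
    fromUnitTorusN L t i k ∈ Ioc 0 L := by
  rw [fromUnitTorusN_apply_apply]
  have h := (AddCircle.equivIoc 1 0 (t (i, k))).2
  have h1 : (0 : ℝ) < (AddCircle.equivIoc 1 0 (t (i, k)) : ℝ) := h.1
  have h2 : ((AddCircle.equivIoc 1 0 (t (i, k)) : ℝ)) ≤ 0 + 1 := h.2
  exact ⟨mul_pos hL h1, by nlinarith [h2]⟩

/-- Translating along the `(i, k)`-line does not move the other coordinates of the representative. [folklore] -/
theorem fromUnitTorusN_add_single_of_ne (L : ℝ) (t : UnitAddTorus (Fin N × Fin 3)) {i : Fin N} {k : Fin 3}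
    (c : UnitAddCircle) {a : Fin N} {l : Fin 3} (h : (a, l) ≠ (i, k)) :
    fromUnitTorusN L (t + Pi.single (i, k) c) a l = fromUnitTorusN L t a l := by
  rw [fromUnitTorusN_apply_apply, fromUnitTorusN_apply_apply, Pi.add_apply, Pi.single_eq_of_ne h, add_zero]

/-- Along the `(i, k)`-line the `(i, k)` coordinate of the representative moves linearly up to lattice jumps. [folklore] -/
theorem exists_fromUnitTorusN_add_single_self (hL : 0 < L) (t : UnitAddTorus (Fin N × Fin 3)) (i : Fin N) (k : Fin 3)
    (x : ℝ) : ∃ m : ℤ, fromUnitTorusN L (t + Pi.single (i, k) ((x : ℝ) : UnitAddCircle)) i k =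
      fromUnitTorusN L t i k + L * x + L * m := by
  obtain ⟨m, hm⟩ := exists_fromUnitTorusN_toUnitTorusN_eq hL
    (fromUnitTorusN L t + (L * x) • (Pi.single i (EuclideanSpace.single k (1 : ℝ)) : Config N))
  rw [toUnitTorusN_add, toUnitTorusN_fromUnitTorusN hL.ne', toUnitTorusN_smul_single hL.ne'] at hm
  refine ⟨m i k, ?_⟩
  rw [hm]
  simp [latticeVecN_apply]

/-- **The shear bound.** Let `i ≠ j`, `0 < r ≤ L/2`, `E ⊆ F` measurable subsets of the torus with `F` invariant along
the `(i, k)`-lines and `E` contained in `{∃ m ∈ ℤ, |(xᵢ - xⱼ)_k - Lm| < r}`. Then `|E| ≤ (8r/L) |F|`. [folklore] -/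
theorem volume_shear_le (hL : 0 < L) {i j : Fin N} (hij : i ≠ j) (k : Fin 3) {r : ℝ} (hr : 0 < r) (hrL : r ≤ L / 2)
    {E F : Set (UnitAddTorus (Fin N × Fin 3))} (hE : MeasurableSet E) (hF : MeasurableSet F) (hEF : E ⊆ F)
    (hFinv : ∀ (t : UnitAddTorus (Fin N × Fin 3)) (c : UnitAddCircle), t + Pi.single (i, k) c ∈ F ↔ t ∈ F)
    (hEC : E ⊆ {t | ∃ m : ℤ, |fromUnitTorusN L t i k - fromUnitTorusN L t j k - L * m| < r}) :
    volume E ≤ ENNReal.ofReal (8 * r / L) * volume F := by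
  classical
  -- the sections
  have key : ∀ (t : UnitAddTorus (Fin N × Fin 3)) (x : ℝ), x ∈ Icc (0 : ℝ) 1 →
      t + Pi.single (i, k) ((x : ℝ) : UnitAddCircle) ∈ E →
        t ∈ F ∧ x ∈ ⋃ m ∈ ({-1, 0, 1, 2} : Finset ℤ),
          ball ((L * m - (fromUnitTorusN L t i k - fromUnitTorusN L t j k)) / L) (r / L) := by
    intro t x hx hmem
    refine ⟨(hFinv t _).1 (hEF hmem), ?_⟩
    obtain ⟨m, hm⟩ := hEC hmem
    obtain ⟨m', hm'⟩ := exists_fromUnitTorusN_add_single_self hL t i k x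
    rw [hm', fromUnitTorusN_add_single_of_ne L t _ (fun h => hij (Prod.ext_iff.1 h).1.symm)] at hm
    set d : ℝ := fromUnitTorusN L t i k - fromUnitTorusN L t j k with hd
    have hdi := fromUnitTorusN_apply_apply_mem hL t i k
    have hdj := fromUnitTorusN_apply_apply_mem hL t j k
    have hm2 : |d + L * x - L * (m - m')| < r := by
      convert hm using 2; rw [hd]; push_cast; ring
    -- the integer `m - m'` is among `-1, 0, 1, 2`
    have hrange : m - m' ∈ ({-1, 0, 1, 2} : Finset ℤ) := by
      have h1 := (abs_lt.1 hm2).1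
      have h2 := (abs_lt.1 hm2).2
      have hlo : (-2 : ℝ) < (m - m' : ℤ) := by
        by_contra hcon
        push Not at hcon
        have : L * ((m - m' : ℤ) : ℝ) ≤ L * (-2) := mul_le_mul_of_nonneg_left hcon hL.le
        push_cast at this h1 h2
        nlinarith [hdi.1, hdj.2, hx.1]
      have hhi : ((m - m' : ℤ) : ℝ) < 3 := by
        by_contra hcon
        push Not at hcon
        have : L * 3 ≤ L * ((m - m' : ℤ) : ℝ) := mul_le_mul_of_nonneg_left hcon hL.le
        push_cast at this h1 h2
        nlinarith [hdi.2, hdj.1, hx.2]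
      have hlo' : -2 < m - m' := by exact_mod_cast hlo
      have hhi' : m - m' < 3 := by exact_mod_cast hhi
      simp only [Finset.mem_insert, Finset.mem_singleton]
      omega
    refine mem_iUnion₂.2 ⟨m - m', hrange, ?_⟩
    rw [mem_ball, Real.dist_eq]
    have : x - (L * ((m - m' : ℤ) : ℝ) - d) / L = (d + L * x - L * (m - m')) / L := by
      push_cast; field_simp; ring
    rw [this, abs_div, abs_of_pos hL]
    exact div_lt_div_of_pos_right hm2 hL
  -- the measure of the sections
  have hsec : ∀ t : UnitAddTorus (Fin N × Fin 3),
      ∫⁻ x in Icc (0 : ℝ) 1, E.indicator (1 : UnitAddTorus (Fin N × Fin 3) → ℝ≥0∞) (t + Pi.single (i, k) ((x : ℝ) : UnitAddCircle)) ≤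
        F.indicator (1 : UnitAddTorus (Fin N × Fin 3) → ℝ≥0∞) t * ENNReal.ofReal (8 * r / L) := by
    intro t
    by_cases ht : t ∈ F
    · rw [indicator_of_mem ht, Pi.one_apply, one_mul]
      set B : Set ℝ := ⋃ m ∈ ({-1, 0, 1, 2} : Finset ℤ),
        ball ((L * m - (fromUnitTorusN L t i k - fromUnitTorusN L t j k)) / L) (r / L) with hB
      calc ∫⁻ x in Icc (0 : ℝ) 1, E.indicator (1 : UnitAddTorus (Fin N × Fin 3) → ℝ≥0∞)
            (t + Pi.single (i, k) ((x : ℝ) : UnitAddCircle))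
          ≤ ∫⁻ x in Icc (0 : ℝ) 1, B.indicator (1 : ℝ → ℝ≥0∞) x := by
            refine setLIntegral_mono' measurableSet_Icc fun x hx => ?_
            by_cases hmem : t + Pi.single (i, k) ((x : ℝ) : UnitAddCircle) ∈ E
            · rw [indicator_of_mem hmem, indicator_of_mem ((key t x hx hmem).2), Pi.one_apply, Pi.one_apply]
            · rw [indicator_of_notMem hmem]; exact zero_le
        _ ≤ ∫⁻ x, B.indicator (1 : ℝ → ℝ≥0∞) x := setLIntegral_le_lintegral _ _
        _ = volume B := lintegral_indicator_one (by
            refine MeasurableSet.biUnion (Finset.countable_toSet _) fun m _ => measurableSet_ball)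
        _ ≤ ∑ m ∈ ({-1, 0, 1, 2} : Finset ℤ),
              volume (ball ((L * m - (fromUnitTorusN L t i k - fromUnitTorusN L t j k)) / L) (r / L)) :=
            measure_biUnion_finset_le _ _
        _ = ∑ _m ∈ ({-1, 0, 1, 2} : Finset ℤ), ENNReal.ofReal (2 * (r / L)) := by
            simp only [Real.volume_ball]
        _ ≤ ENNReal.ofReal (8 * r / L) := by
            rw [Finset.sum_const]
            have hcard : ({-1, 0, 1, 2} : Finset ℤ).card ≤ 4 := Finset.card_le_four
            calc ({-1, 0, 1, 2} : Finset ℤ).card • ENNReal.ofReal (2 * (r / L))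
                ≤ 4 • ENNReal.ofReal (2 * (r / L)) := nsmul_le_nsmul_left zero_le hcard
              _ = ENNReal.ofReal (8 * r / L) := by
                  rw [nsmul_eq_mul, show ((4 : ℕ) : ℝ≥0∞) = ENNReal.ofReal 4 by simp,
                    ← ENNReal.ofReal_mul (by norm_num)]
                  congr 1; ring
    · have h0 : ∀ x ∈ Icc (0 : ℝ) 1, E.indicator (1 : UnitAddTorus (Fin N × Fin 3) → ℝ≥0∞)
          (t + Pi.single (i, k) ((x : ℝ) : UnitAddCircle)) = 0 := fun x hx => by
        rw [indicator_of_notMem]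
        exact fun hmem => ht (key t x hx hmem).1
      rw [setLIntegral_congr_fun measurableSet_Icc h0, lintegral_zero]
      exact zero_le
  -- translation–Tonelli
  have hT := Torus.lintegral_lintegral_line_eq (i, k) (measurable_one.indicator hE) 0 1
  rw [sub_zero, ENNReal.ofReal_one, one_mul, lintegral_indicator_one hE] at hT
  rw [← hT]
  calc ∫⁻ t, ∫⁻ x in Icc (0 : ℝ) 1, E.indicator 1 (t + Pi.single (i, k) ((x : ℝ) : UnitAddCircle))
      ≤ ∫⁻ t, F.indicator (1 : UnitAddTorus (Fin N × Fin 3) → ℝ≥0∞) t * ENNReal.ofReal (8 * r / L) := lintegral_mono hsec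
    _ = ENNReal.ofReal (8 * r / L) * volume F := by
        rw [lintegral_mul_const _ (measurable_one.indicator hF), lintegral_indicator_one hF, mul_comm]

/-- The coordinate conditions `C_k = {∃ m ∈ ℤ, |(xᵢ - xⱼ)_k - Lm| < r}` are measurable. [folklore] -/
theorem measurableSet_coordNear (L : ℝ) (i j : Fin N) (k : Fin 3) (r : ℝ) :
    MeasurableSet {t : UnitAddTorus (Fin N × Fin 3) | ∃ m : ℤ,
      |fromUnitTorusN L t i k - fromUnitTorusN L t j k - L * m| < r} := by
  have hf : Measurable fun t : UnitAddTorus (Fin N × Fin 3) => fromUnitTorusN L t i k - fromUnitTorusN L t j k :=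
    (show Continuous fun X : Config N => X i k - X j k by fun_prop).measurable.comp (measurable_fromUnitTorusN L)
  have h : {t : UnitAddTorus (Fin N × Fin 3) | ∃ m : ℤ, |fromUnitTorusN L t i k - fromUnitTorusN L t j k - L * m| < r} =
      ⋃ m : ℤ, {t | |fromUnitTorusN L t i k - fromUnitTorusN L t j k - L * m| < r} := by
    ext t; simp only [mem_setOf_eq, mem_iUnion]
  rw [h]
  exact MeasurableSet.iUnion fun m => measurableSet_lt
    (continuous_abs.measurable.comp (hf.sub_const (L * (m : ℝ)))) measurable_const

/-- **Near-coincidences of one pair are rare**: for `i ≠ j` and `0 < r ≤ L/2`,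
`|{t : ∃ n, |xᵢ - xⱼ - Ln| < r}| ≤ (8r/L)³` (three shears). [folklore] -/
theorem volume_exists_pairRad_lt_pair_le (hL : 0 < L) {i j : Fin N} (hij : i ≠ j) {r : ℝ} (hr : 0 < r)
    (hrL : r ≤ L / 2) :
    volume {t : UnitAddTorus (Fin N × Fin 3) | ∃ n : Fin 3 → ℤ, pairRad L (fromUnitTorusN L t) i j n < r} ≤
      ENNReal.ofReal (8 * r / L) ^ 3 := by
  set C : Fin 3 → Set (UnitAddTorus (Fin N × Fin 3)) := fun k => {t | ∃ m : ℤ,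
    |fromUnitTorusN L t i k - fromUnitTorusN L t j k - L * m| < r} with hC
  have hCm : ∀ k, MeasurableSet (C k) := fun k => measurableSet_coordNear L i j k r
  set E : Set (UnitAddTorus (Fin N × Fin 3)) := {t | ∃ n : Fin 3 → ℤ, pairRad L (fromUnitTorusN L t) i j n < r} with hE
  have hEm : MeasurableSet E := by
    have h : E = ⋃ n : Fin 3 → ℤ, {t | pairRad L (fromUnitTorusN L t) i j n < r} := by
      ext t; simp only [hE, mem_setOf_eq, mem_iUnion]
    rw [h]
    exact MeasurableSet.iUnion fun n => measurableSet_lt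
      ((continuous_pairRad L i j n).measurable.comp (measurable_fromUnitTorusN L)) measurable_const
  -- `E ⊆ C 0 ∩ C 1 ∩ C 2`
  have hEC : ∀ k, E ⊆ C k := by
    rintro k t ⟨n, hn⟩
    refine ⟨n k, ?_⟩
    have h1 := sq_apply_le_norm_sq (fromUnitTorusN L t i - fromUnitTorusN L t j - latticeVec L n) k
    have h2 : |(fromUnitTorusN L t i - fromUnitTorusN L t j - latticeVec L n) k| ≤
        ‖fromUnitTorusN L t i - fromUnitTorusN L t j - latticeVec L n‖ := abs_le_of_sq_le_sq h1 (norm_nonneg _)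
    rw [pairRad] at hn
    simp only [PiLp.sub_apply, latticeVec_apply] at h2
    exact h2.trans_lt hn
  -- invariance of the coordinate conditions along the other lines of particle `i`
  have hinv : ∀ {k l : Fin 3}, l ≠ k → ∀ (t : UnitAddTorus (Fin N × Fin 3)) (c : UnitAddCircle),
      t + Pi.single (i, k) c ∈ C l ↔ t ∈ C l := by
    intro k l hlk t c
    simp only [hC, mem_setOf_eq]
    rw [fromUnitTorusN_add_single_of_ne L t c (fun h => hlk (Prod.ext_iff.1 h).2),
      fromUnitTorusN_add_single_of_ne L t c (fun h => hij (Prod.ext_iff.1 h).1.symm)]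
  -- three shears
  have hA : volume E ≤ ENNReal.ofReal (8 * r / L) * volume (C 1 ∩ C 2) :=
    volume_shear_le hL hij 0 hr hrL hEm ((hCm 1).inter (hCm 2)) (fun t ht => ⟨hEC 1 ht, hEC 2 ht⟩)
      (fun t c => by rw [mem_inter_iff, mem_inter_iff, hinv (by decide) t c, hinv (by decide) t c]) (hEC 0)
  have hB : volume (C 1 ∩ C 2) ≤ ENNReal.ofReal (8 * r / L) * volume (C 2) :=
    volume_shear_le hL hij 1 hr hrL ((hCm 1).inter (hCm 2)) (hCm 2) inter_subset_right
      (fun t c => hinv (by decide) t c) inter_subset_left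
  have hC' : volume (C 2) ≤ ENNReal.ofReal (8 * r / L) * volume (univ : Set (UnitAddTorus (Fin N × Fin 3))) :=
    volume_shear_le hL hij 2 hr hrL (hCm 2) MeasurableSet.univ (subset_univ _) (fun t c => by simp) (fun t ht => ht)
  rw [measure_univ, mul_one] at hC'
  calc volume E ≤ ENNReal.ofReal (8 * r / L) * volume (C 1 ∩ C 2) := hA
    _ ≤ ENNReal.ofReal (8 * r / L) * (ENNReal.ofReal (8 * r / L) * volume (C 2)) := by gcongr
    _ ≤ ENNReal.ofReal (8 * r / L) * (ENNReal.ofReal (8 * r / L) * ENNReal.ofReal (8 * r / L)) := by gcongr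
    _ = ENNReal.ofReal (8 * r / L) ^ 3 := by ring

end HardLayerAux

open HardLayerAux in
/-- **Near-coincidences are rare**: for `0 < r ≤ L/2`, the torus points whose configuration has an image pair closer
than `r` have Haar measure `≤ N² (8r/L)³`. [folklore] -/
theorem volume_exists_pairRad_lt_le (hL : 0 < L) {r : ℝ} (hr : 0 < r) (hrL : r ≤ L / 2) :
    volume {t : UnitAddTorus (Fin N × Fin 3) | ∃ (i j : Fin N) (n : Fin 3 → ℤ), i ≠ j ∧
      pairRad L (fromUnitTorusN L t) i j n < r} ≤ (N : ℝ≥0∞) ^ 2 * ENNReal.ofReal (8 * r / L) ^ 3 := by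
  have hsub : {t : UnitAddTorus (Fin N × Fin 3) | ∃ (i j : Fin N) (n : Fin 3 → ℤ), i ≠ j ∧
      pairRad L (fromUnitTorusN L t) i j n < r} ⊆
      ⋃ p : Fin N × Fin N, {t | p.1 ≠ p.2 ∧ ∃ n : Fin 3 → ℤ, pairRad L (fromUnitTorusN L t) p.1 p.2 n < r} := by
    rintro t ⟨i, j, n, hij, h⟩
    exact mem_iUnion.2 ⟨(i, j), hij, n, h⟩
  calc volume {t : UnitAddTorus (Fin N × Fin 3) | ∃ (i j : Fin N) (n : Fin 3 → ℤ), i ≠ j ∧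
          pairRad L (fromUnitTorusN L t) i j n < r}
      ≤ volume (⋃ p : Fin N × Fin N, {t : UnitAddTorus (Fin N × Fin 3) | p.1 ≠ p.2 ∧
          ∃ n : Fin 3 → ℤ, pairRad L (fromUnitTorusN L t) p.1 p.2 n < r}) := measure_mono hsub
    _ ≤ ∑ p : Fin N × Fin N, volume {t : UnitAddTorus (Fin N × Fin 3) | p.1 ≠ p.2 ∧
          ∃ n : Fin 3 → ℤ, pairRad L (fromUnitTorusN L t) p.1 p.2 n < r} := measure_iUnion_fintype_le _ _
    _ ≤ ∑ _p : Fin N × Fin N, ENNReal.ofReal (8 * r / L) ^ 3 := by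
        refine Finset.sum_le_sum fun p _ => ?_
        by_cases hp : p.1 = p.2
        · simp [hp]
        · calc volume {t : UnitAddTorus (Fin N × Fin 3) | p.1 ≠ p.2 ∧ ∃ n : Fin 3 → ℤ,
                pairRad L (fromUnitTorusN L t) p.1 p.2 n < r}
              ≤ volume {t : UnitAddTorus (Fin N × Fin 3) | ∃ n : Fin 3 → ℤ, pairRad L (fromUnitTorusN L t) p.1 p.2 n < r} :=
                measure_mono fun t ht => ht.2
            _ ≤ _ := volume_exists_pairRad_lt_pair_le hL hp hr hrL
    _ = (N : ℝ≥0∞) ^ 2 * ENNReal.ofReal (8 * r / L) ^ 3 := by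
        rw [Finset.sum_const, Finset.card_univ, Fintype.card_prod, Fintype.card_fin, nsmul_eq_mul]
        push_cast
        ring

end Literature.MathematicalPhysics.QuantumManyBody.BoseGas

end
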